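import Mathlib
import Literature.Analysis.FluidPDE.GaussianVortexPlanar
import Literature.Analysis.FluidPDE.GaussianVortexPlanarProofs
import Literature.Analysis.FluidPDE.BiotSavart2DSymmetry
import Summits.AnomalousDissipation.AnomalousDissipation.Theorems.MarginalStabilityChainStretchedVortexRowsStubCoreInverseAngular
import Summits.AnomalousDissipation.AnomalousDissipation.Theorems.MarginalStabilityChainStretchedVortexRowsStubLogPotentialTools
import Summits.AnomalousDissipation.AnomalousDissipation.Theorems.MarginalStabilityChainStretchedVortexRowsStubLogPotentialGradient
import HarnessLib

/-!
# Helper `inner_id_biotSavart2D_eq_neg_logConv_angularDeriv` toward stub `stub_coreInverse` of the line `braid-closed-large-circulation-gluing`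
# (crux stmt-AnomalousDissipation-3009, `MarginalStabilityChain.StretchedVortexRows`)

The radial component of the planar Biot–Savart velocity is minus the logarithmic potential of the angular
derivative: for `w ∈ C¹(ℝ²)` of Gaussian class `|w| + ‖Dw‖ ≤ A (1 + |η|)^k G`,

  `ξ · (K ∗ w)(ξ) = −∫ N(ξ − η) ∂_θ w(η) dη`,  `N = (2π)⁻¹ log |·|`, `∂_θ w(η) = Dw(η)[η^⊥]`, `K(z) = z^⊥/(2π|z|²)`,

and the integrand on the right is integrable (`ℝ² = EuclideanSpace ℝ (Fin 2)`).

Proof. (i) Kernel identity: `z · z^⊥ = 0` and `(ξ − η)^⊥ = ξ^⊥ − η^⊥` give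
`ξ · K(ξ − η) = −(2π|ξ − η|²)⁻¹ ξ · η^⊥`, so `ξ · (K ∗ w)(ξ) = −∫ (2π)⁻¹ (ξ · η^⊥) |ξ − η|⁻² w(η) dη` (the inner
product with a constant vector commutes with the absolutely convergent Biot–Savart integral).
(ii) The angular derivative in coordinates: `∂_θ w = −η₁ ∂₀w + η₀ ∂₁w = −∂₀(η₁ w) + ∂₁(η₀ w)` (the coordinate
`η₁` does not depend on `η₀` and vice versa), and the coordinate multiples `η_j w` are again `C¹` of Gaussian class.
(iii) The singular integration by parts against the logarithmic kernel in a FIXED direction `v`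
(landed helper `integral_logKernel_mul_fderiv_eq`, obtained there from the regularised kernel
`(4π)⁻¹ log(|z|² + ε²)` and dominated convergence `ε → 0`):
`∫ N(ξ − η) ∂_v f(η) dη = ∫ (2π)⁻¹ ((ξ − η) · v) |ξ − η|⁻² f(η) dη`. Applied to `f = η₁ w, v = e₀` and
`f = η₀ w, v = e₁` and subtracted:
`∫ N(ξ − η) ∂_θ w(η) dη = ∫ (2π)⁻¹ (−(ξ₀ − η₀) η₁ + (ξ₁ − η₁) η₀) |ξ − η|⁻² w(η) dη = ∫ (2π)⁻¹ (ξ · η^⊥) |ξ − η|⁻² w(η) dη`,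
since `−(ξ₀ − η₀)η₁ + (ξ₁ − η₁)η₀ = ξ₁η₀ − ξ₀η₁ = ξ · η^⊥`. Comparing with (i) gives the claim. The integrability of
`N(ξ − ·) ∂_θ w` follows from `|log |ξ − η|| ≤ 𝟙_{|ξ−η|<1}(−log |ξ − η|) + log(1 + |ξ|) + |η|` (local integrability of
the logarithm in the plane) and the Gaussian decay of `|η| ‖Dw(η)‖`.

References: standard two-dimensional potential theory (logarithmic potential and Biot–Savart law,
Th. Gallay, C. E. Wayne, Comm. Math. Phys. 255 (2005), §1, and J. Math. Fluid Mech. 9 (2007), (1.3)).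
-/

set_option linter.dupNamespace false

noncomputable section

open scoped RealInnerProductSpace Topology ContDiff
open MeasureTheory WithLp Function Metric Filter Set

namespace Summit.AnomalousDissipation.AnomalousDissipation.Theorems.MarginalStabilityChainStretchedVortexRows

open Literature.Analysis.FluidPDE

/-! ### Integrability against the logarithmic kernel -/

/-- For a continuous `h` with `|h(η)| ≤ B (1 + |η|) e^{−|η|²/8}`, the function `η ↦ (2π)⁻¹ log |ξ − η| h(η)` is
integrable on `ℝ²` (`|log |ξ − η|| ≤ 𝟙_{|ξ−η|<1}(−log|ξ − η|) + log(1 + |ξ|) + |η|`, the first term supported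
where `|η| ≤ |ξ| + 1`). [folklore] -/
theorem integrable_logKernel_mul_of_le {B : ℝ} {h : EuclideanSpace ℝ (Fin 2) → ℝ} (hh : Continuous h)
    (hb : ∀ η, |h η| ≤ B * (1 + ‖η‖) * Real.exp (-(1 / 8) * ‖η‖ ^ 2)) (ξ : EuclideanSpace ℝ (Fin 2)) :
    Integrable fun η : EuclideanSpace ℝ (Fin 2) => (2 * Real.pi)⁻¹ * Real.log ‖ξ - η‖ * h η := by
  have hB : 0 ≤ B := (abs_nonneg _).trans ((hb 0).trans (le_of_eq (by simp)))
  have hc0 : 0 ≤ Real.log (1 + ‖ξ‖) := Real.log_nonneg (by linarith [norm_nonneg ξ])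
  have hi0 : Integrable fun η : EuclideanSpace ℝ (Fin 2) =>
      (ball (0 : EuclideanSpace ℝ (Fin 2)) 1).indicator (fun z => -Real.log ‖z‖) (ξ - η) :=
    integrable_indicator_neg_log_norm.comp_sub_left ξ
  have hi2 := integrable_one_add_norm_pow_mul_exp_eighth 2
  set bound : EuclideanSpace ℝ (Fin 2) → ℝ := fun η => (2 * Real.pi)⁻¹ * B *
    ((2 + ‖ξ‖) * (ball (0 : EuclideanSpace ℝ (Fin 2)) 1).indicator (fun z => -Real.log ‖z‖) (ξ - η) +
      (Real.log (1 + ‖ξ‖) + 1) * ((1 + ‖η‖) ^ 2 * Real.exp (-(1 / 8) * ‖η‖ ^ 2))) with hbound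
  have hbi : Integrable bound :=
    ((hi0.const_mul (2 + ‖ξ‖)).add (hi2.const_mul (Real.log (1 + ‖ξ‖) + 1))).const_mul _
  refine hbi.mono' ?_ (Eventually.of_forall fun η => ?_)
  · exact ((measurable_const.mul (measurable_const.sub measurable_id).norm.log).mul
      hh.measurable).aestronglyMeasurable
  rw [Real.norm_eq_abs, abs_mul, abs_mul, abs_of_pos (by positivity : (0:ℝ) < (2 * Real.pi)⁻¹)]
  have h1 := abs_log_norm_sub_le ξ η
  have h2 := hb η
  have h4 := indicator_neg_log_norm_nonneg (ξ - η)
  have he1 : Real.exp (-(1 / 8) * ‖η‖ ^ 2) ≤ 1 := Real.exp_le_one_iff.2 (by nlinarith [norm_nonneg η])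
  have he0 : 0 ≤ Real.exp (-(1 / 8) * ‖η‖ ^ 2) := (Real.exp_pos _).le
  have hC1 : (ball (0 : EuclideanSpace ℝ (Fin 2)) 1).indicator (fun z => -Real.log ‖z‖) (ξ - η) * (1 + ‖η‖) ≤
      (2 + ‖ξ‖) * (ball (0 : EuclideanSpace ℝ (Fin 2)) 1).indicator (fun z => -Real.log ‖z‖) (ξ - η) := by
    by_cases hmem : ξ - η ∈ ball (0 : EuclideanSpace ℝ (Fin 2)) 1
    · have hη : ‖η‖ ≤ ‖ξ‖ + 1 := by
        rw [mem_ball_zero_iff] at hmem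
        have := norm_sub_le ξ (ξ - η)
        rw [sub_sub_cancel] at this
        linarith
      nlinarith
    · rw [indicator_of_notMem hmem, zero_mul, mul_zero]
  set L0 := (ball (0 : EuclideanSpace ℝ (Fin 2)) 1).indicator (fun z => -Real.log ‖z‖) (ξ - η) with hL0
  set e := Real.exp (-(1 / 8) * ‖η‖ ^ 2) with he
  have h6 : 0 ≤ L0 + Real.log (1 + ‖ξ‖) + ‖η‖ := by positivity
  have hc : (0:ℝ) ≤ (2 * Real.pi)⁻¹ := by positivity
  have i1 : L0 * (1 + ‖η‖) * e ≤ (2 + ‖ξ‖) * L0 :=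
    (mul_le_of_le_one_right (by positivity) he1).trans hC1
  have i2 : (Real.log (1 + ‖ξ‖) + ‖η‖) * (1 + ‖η‖) * e ≤
      (Real.log (1 + ‖ξ‖) + 1) * ((1 + ‖η‖) ^ 2 * e) := by
    have h7 : Real.log (1 + ‖ξ‖) + ‖η‖ ≤ (Real.log (1 + ‖ξ‖) + 1) * (1 + ‖η‖) := by
      nlinarith [norm_nonneg η]
    have h8 : 0 ≤ (1 + ‖η‖) * e := by positivity
    calc (Real.log (1 + ‖ξ‖) + ‖η‖) * (1 + ‖η‖) * e = (Real.log (1 + ‖ξ‖) + ‖η‖) * ((1 + ‖η‖) * e) := by ring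
      _ ≤ (Real.log (1 + ‖ξ‖) + 1) * (1 + ‖η‖) * ((1 + ‖η‖) * e) := mul_le_mul_of_nonneg_right h7 h8
      _ = (Real.log (1 + ‖ξ‖) + 1) * ((1 + ‖η‖) ^ 2 * e) := by ring
  calc (2 * Real.pi)⁻¹ * |Real.log ‖ξ - η‖| * |h η|
      ≤ (2 * Real.pi)⁻¹ * (L0 + Real.log (1 + ‖ξ‖) + ‖η‖) * (B * (1 + ‖η‖) * e) :=
        mul_le_mul (mul_le_mul_of_nonneg_left h1 hc) h2 (abs_nonneg _) (mul_nonneg hc h6)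
    _ = (2 * Real.pi)⁻¹ * B * (L0 * (1 + ‖η‖) * e + (Real.log (1 + ‖ξ‖) + ‖η‖) * (1 + ‖η‖) * e) := by ring
    _ ≤ (2 * Real.pi)⁻¹ * B * ((2 + ‖ξ‖) * L0 + (Real.log (1 + ‖ξ‖) + 1) * ((1 + ‖η‖) ^ 2 * e)) :=
        mul_le_mul_of_nonneg_left (add_le_add i1 i2) (mul_nonneg hc hB)
    _ = bound η := by simp only [hbound, hL0, he]

/-! ### Coordinate multiples `η_j w` of a Gaussian-class function -/

section CoordMul

variable {w : EuclideanSpace ℝ (Fin 2) → ℝ} (hw : ContDiff ℝ 1 w)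
include hw

/-- `D(η_j w)(η) = η_j Dw(η) + w(η) e_j^*`. [folklore] -/
theorem hasFDerivAt_coord_mul (j : Fin 2) (η : EuclideanSpace ℝ (Fin 2)) :
    HasFDerivAt (fun η : EuclideanSpace ℝ (Fin 2) => η j * w η)
      ((η j) • fderiv ℝ w η +
        (w η) • (EuclideanSpace.proj j : EuclideanSpace ℝ (Fin 2) →L[ℝ] ℝ)) η := by
  have hc : HasFDerivAt (fun y : EuclideanSpace ℝ (Fin 2) => y j)
      (EuclideanSpace.proj j : EuclideanSpace ℝ (Fin 2) →L[ℝ] ℝ) η :=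
    (EuclideanSpace.proj j : EuclideanSpace ℝ (Fin 2) →L[ℝ] ℝ).hasFDerivAt
  exact hc.fun_mul ((hw.differentiable one_ne_zero) η).hasFDerivAt

/-- `η ↦ η_j w(η)` is `C¹`. [folklore] -/
theorem contDiff_coord_mul (j : Fin 2) : ContDiff ℝ 1 fun η : EuclideanSpace ℝ (Fin 2) => η j * w η := by
  have hc : ContDiff ℝ 1 fun y : EuclideanSpace ℝ (Fin 2) => y j :=
    (EuclideanSpace.proj j : EuclideanSpace ℝ (Fin 2) →L[ℝ] ℝ).contDiff
  exact hc.mul hw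

/-- `D(η_j w)(η)[v] = η_j Dw(η)[v] + w(η) v_j`. [folklore] -/
theorem fderiv_coord_mul_apply (j : Fin 2) (η v : EuclideanSpace ℝ (Fin 2)) :
    fderiv ℝ (fun η : EuclideanSpace ℝ (Fin 2) => η j * w η) η v = η j * fderiv ℝ w η v + w η * v j := by
  rw [(hasFDerivAt_coord_mul hw j η).fderiv]
  simp

/-- `‖D(η_j w)(η)‖ ≤ |η| ‖Dw(η)‖ + |w(η)|`. [folklore] -/
theorem norm_fderiv_coord_mul_le (j : Fin 2) (η : EuclideanSpace ℝ (Fin 2)) :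
    ‖fderiv ℝ (fun η : EuclideanSpace ℝ (Fin 2) => η j * w η) η‖ ≤ ‖η‖ * ‖fderiv ℝ w η‖ + |w η| := by
  refine ContinuousLinearMap.opNorm_le_bound _ (by positivity) fun v => ?_
  rw [fderiv_coord_mul_apply hw j η v, Real.norm_eq_abs]
  have h1 : |η j| ≤ ‖η‖ := by
    simpa [Real.norm_eq_abs] using (EuclideanSpace.norm_eq η ▸ PiLp.norm_apply_le η j)
  have h2 : |v j| ≤ ‖v‖ := by
    simpa [Real.norm_eq_abs] using (EuclideanSpace.norm_eq v ▸ PiLp.norm_apply_le v j)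
  have h3 : |fderiv ℝ w η v| ≤ ‖fderiv ℝ w η‖ * ‖v‖ := by
    rw [← Real.norm_eq_abs]; exact ContinuousLinearMap.le_opNorm _ _
  calc |η j * fderiv ℝ w η v + w η * v j| ≤ |η j * fderiv ℝ w η v| + |w η * v j| := abs_add_le _ _
    _ = |η j| * |fderiv ℝ w η v| + |w η| * |v j| := by rw [abs_mul, abs_mul]
    _ ≤ ‖η‖ * (‖fderiv ℝ w η‖ * ‖v‖) + |w η| * ‖v‖ := by gcongr
    _ = (‖η‖ * ‖fderiv ℝ w η‖ + |w η|) * ‖v‖ := by ring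

/-- The coordinate multiple of a Gaussian-class function is of Gaussian class, one power higher:
`|η_j w| + ‖D(η_j w)‖ ≤ A (1 + |η|)^{k+1} G`. [folklore] -/
theorem coord_mul_gaussClass {k : ℕ} {A : ℝ}
    (hb : ∀ η, |w η| + ‖fderiv ℝ w η‖ ≤ A * (1 + ‖η‖) ^ k * gaussVortexProfile η) (j : Fin 2)
    (η : EuclideanSpace ℝ (Fin 2)) :
    |η j * w η| + ‖fderiv ℝ (fun η : EuclideanSpace ℝ (Fin 2) => η j * w η) η‖ ≤
      A * (1 + ‖η‖) ^ (k + 1) * gaussVortexProfile η := by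
  have h1 : |η j| ≤ ‖η‖ := by
    simpa [Real.norm_eq_abs] using (EuclideanSpace.norm_eq η ▸ PiLp.norm_apply_le η j)
  have h2 := norm_fderiv_coord_mul_le hw j η
  have h3 : (1 + ‖η‖) * (|w η| + ‖fderiv ℝ w η‖) ≤ (1 + ‖η‖) * (A * (1 + ‖η‖) ^ k * gaussVortexProfile η) :=
    mul_le_mul_of_nonneg_left (hb η) (by positivity)
  calc |η j * w η| + ‖fderiv ℝ (fun η : EuclideanSpace ℝ (Fin 2) => η j * w η) η‖
      ≤ ‖η‖ * |w η| + (‖η‖ * ‖fderiv ℝ w η‖ + |w η|) := by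
        rw [abs_mul]; gcongr
    _ ≤ (1 + ‖η‖) * (|w η| + ‖fderiv ℝ w η‖) := by
        nlinarith [norm_nonneg η, abs_nonneg (w η), norm_nonneg (fderiv ℝ w η)]
    _ ≤ (1 + ‖η‖) * (A * (1 + ‖η‖) ^ k * gaussVortexProfile η) := h3
    _ = A * (1 + ‖η‖) ^ (k + 1) * gaussVortexProfile η := by ring

/-- **Logarithmic potential of a weighted partial derivative**: for `i ≠ j`,
`∫ N(ξ − η) η_j ∂_i w(η) dη = ∫ (2π)⁻¹ (ξ_i − η_i) |ξ − η|⁻² η_j w(η) dη` (`η_j ∂_i w = ∂_i(η_j w)` and the singular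
integration by parts against `N = (2π)⁻¹ log |·|` in the fixed direction `e_i`), both integrands being integrable. [folklore] -/
theorem integral_logKernel_mul_coord_mul_fderiv {k : ℕ} {A : ℝ}
    (hb : ∀ η, |w η| + ‖fderiv ℝ w η‖ ≤ A * (1 + ‖η‖) ^ k * gaussVortexProfile η)
    (ξ : EuclideanSpace ℝ (Fin 2)) {i j : Fin 2} (hij : i ≠ j) :
    Integrable (fun η : EuclideanSpace ℝ (Fin 2) =>
        (2 * Real.pi)⁻¹ * Real.log ‖ξ - η‖ * (η j * fderiv ℝ w η (EuclideanSpace.single i 1))) ∧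
      Integrable (fun η : EuclideanSpace ℝ (Fin 2) =>
        (2 * Real.pi)⁻¹ * ⟪ξ - η, EuclideanSpace.single i 1⟫ / ‖ξ - η‖ ^ 2 * (η j * w η)) ∧
      ∫ η, (2 * Real.pi)⁻¹ * Real.log ‖ξ - η‖ * (η j * fderiv ℝ w η (EuclideanSpace.single i 1)) =
        ∫ η, (2 * Real.pi)⁻¹ * ⟪ξ - η, EuclideanSpace.single i 1⟫ / ‖ξ - η‖ ^ 2 * (η j * w η) := by
  have hf := contDiff_coord_mul hw j
  obtain ⟨B, hB0, hf0, hf1⟩ := gaussClass_reduce (coord_mul_gaussClass hw hb j)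
  have key : ∀ η : EuclideanSpace ℝ (Fin 2),
      fderiv ℝ (fun η : EuclideanSpace ℝ (Fin 2) => η j * w η) η (EuclideanSpace.single i 1) =
        η j * fderiv ℝ w η (EuclideanSpace.single i 1) := by
    intro η
    rw [fderiv_coord_mul_apply hw j η, PiLp.single_apply, if_neg hij.symm, mul_zero, add_zero]
  refine ⟨?_, integrable_kernel_mul hf.continuous hf0 ξ (EuclideanSpace.single i 1), ?_⟩
  · refine integrable_logKernel_mul_of_le (B := B) ?_ (fun η => ?_) ξ
    · exact ((continuous_apply j).comp (PiLp.continuous_ofLp 2 _)).mul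
        ((hw.continuous_fderiv one_ne_zero).clm_apply continuous_const)
    · rw [← key η]
      have he0 : 0 ≤ Real.exp (-(1 / 8) * ‖η‖ ^ 2) := (Real.exp_pos _).le
      calc |fderiv ℝ (fun η : EuclideanSpace ℝ (Fin 2) => η j * w η) η (EuclideanSpace.single i 1)|
          = ‖fderiv ℝ (fun η : EuclideanSpace ℝ (Fin 2) => η j * w η) η (EuclideanSpace.single i 1)‖ :=
            (Real.norm_eq_abs _).symm
        _ ≤ ‖fderiv ℝ (fun η : EuclideanSpace ℝ (Fin 2) => η j * w η) η‖ * ‖EuclideanSpace.single i (1:ℝ)‖ :=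
            ContinuousLinearMap.le_opNorm _ _
        _ = ‖fderiv ℝ (fun η : EuclideanSpace ℝ (Fin 2) => η j * w η) η‖ := by simp
        _ ≤ B * Real.exp (-(1 / 8) * ‖η‖ ^ 2) := hf1 η
        _ ≤ B * (1 + ‖η‖) * Real.exp (-(1 / 8) * ‖η‖ ^ 2) := by
            rw [mul_assoc B]
            exact mul_le_mul_of_nonneg_left (le_mul_of_one_le_left he0 (by linarith [norm_nonneg η])) hB0
  · have h := integral_logKernel_mul_fderiv_eq hf hf0 hf1 ξ (EuclideanSpace.single i 1)
    simp_rw [key] at h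
    exact h

end CoordMul

/-- W3-D (angular identity behind the Biot–Savart part of the rotation term): for `w ∈ C¹` of Gaussian class,
`ξ·(K∗w)(ξ) = −(N ∗ ∂_θw)(ξ)` with `N = (2π)⁻¹ log|·|`, `∂_θw = Dw[ξ^⊥]`
(kernel identity `ξ·K(ξ−η) = −∇N(ξ−η)·η^⊥` and one integration by parts in `θ_η`). -/
theorem inner_id_biotSavart2D_eq_neg_logConv_angularDeriv :
    ∀ (k : ℕ) (A : ℝ) (w : EuclideanSpace ℝ (Fin 2) → ℝ), ContDiff ℝ 1 w →
      (∀ η, |w η| + ‖fderiv ℝ w η‖ ≤ A * (1 + ‖η‖) ^ k * gaussVortexProfile η) →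
      ∀ ξ, Integrable (fun η => (2 * Real.pi)⁻¹ * Real.log ‖ξ - η‖ * fderiv ℝ w η (perp η)) ∧
        ⟪ξ, biotSavart2D w ξ⟫ = -∫ η, (2 * Real.pi)⁻¹ * Real.log ‖ξ - η‖ * fderiv ℝ w η (perp η) := by
  intro k A w hw hb ξ
  obtain ⟨B, hB0, hw0, -⟩ := gaussClass_reduce hb
  obtain ⟨hI10, hK10, hE10⟩ :=
    integral_logKernel_mul_coord_mul_fderiv hw hb ξ (i := 0) (j := 1) (by decide)
  obtain ⟨hI01, hK01, hE01⟩ :=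
    integral_logKernel_mul_coord_mul_fderiv hw hb ξ (i := 1) (j := 0) (by decide)
  -- the angular derivative in coordinates: `∂_θ w = η₀ ∂₁w − η₁ ∂₀w`
  have hdec : ∀ η : EuclideanSpace ℝ (Fin 2),
      (2 * Real.pi)⁻¹ * Real.log ‖ξ - η‖ * fderiv ℝ w η (perp η) =
        (2 * Real.pi)⁻¹ * Real.log ‖ξ - η‖ * (η 0 * fderiv ℝ w η (EuclideanSpace.single 1 1)) -
          (2 * Real.pi)⁻¹ * Real.log ‖ξ - η‖ * (η 1 * fderiv ℝ w η (EuclideanSpace.single 0 1)) := by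
    intro η
    rw [fderiv_apply_perp]
    ring
  refine ⟨(hI01.sub' hI10).congr (Eventually.of_forall fun η => (hdec η).symm), ?_⟩
  -- the Biot–Savart integral converges absolutely (`w ∈ L¹ ∩ L^∞`)
  have he1 : ∀ η : EuclideanSpace ℝ (Fin 2), Real.exp (-(1 / 8) * ‖η‖ ^ 2) ≤ 1 := fun η =>
    Real.exp_le_one_iff.2 (by nlinarith [norm_nonneg η])
  have hwi : Integrable w := by
    refine ((integrable_one_add_norm_pow_mul_exp_eighth 0).const_mul B).mono'
      hw.continuous.aestronglyMeasurable (Eventually.of_forall fun η => ?_)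
    rw [Real.norm_eq_abs, pow_zero, one_mul]
    exact hw0 η
  have hwb : ∀ y, |w y| ≤ B := fun y => (hw0 y).trans (mul_le_of_le_one_right hB0 (he1 y))
  have hK : Integrable (fun η => w η • biotSavartKernel2D (ξ - η)) :=
    integrable_smul_biotSavartKernel2D hwi hwb ξ
  -- the logarithmic potential of the angular derivative, by two fixed-direction integrations by parts
  have hR : ∫ η, (2 * Real.pi)⁻¹ * Real.log ‖ξ - η‖ * fderiv ℝ w η (perp η) =
      ∫ η, (2 * Real.pi)⁻¹ * ⟪ξ, perp η⟫ / ‖ξ - η‖ ^ 2 * w η := by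
    calc ∫ η, (2 * Real.pi)⁻¹ * Real.log ‖ξ - η‖ * fderiv ℝ w η (perp η)
        = ∫ η, ((2 * Real.pi)⁻¹ * Real.log ‖ξ - η‖ * (η 0 * fderiv ℝ w η (EuclideanSpace.single 1 1)) -
            (2 * Real.pi)⁻¹ * Real.log ‖ξ - η‖ * (η 1 * fderiv ℝ w η (EuclideanSpace.single 0 1))) :=
          integral_congr_ae (Eventually.of_forall hdec)
      _ = (∫ η, (2 * Real.pi)⁻¹ * Real.log ‖ξ - η‖ * (η 0 * fderiv ℝ w η (EuclideanSpace.single 1 1))) -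
            ∫ η, (2 * Real.pi)⁻¹ * Real.log ‖ξ - η‖ * (η 1 * fderiv ℝ w η (EuclideanSpace.single 0 1)) :=
          integral_sub hI01 hI10
      _ = (∫ η, (2 * Real.pi)⁻¹ * ⟪ξ - η, EuclideanSpace.single 1 1⟫ / ‖ξ - η‖ ^ 2 * (η 0 * w η)) -
            ∫ η, (2 * Real.pi)⁻¹ * ⟪ξ - η, EuclideanSpace.single 0 1⟫ / ‖ξ - η‖ ^ 2 * (η 1 * w η) := by
          rw [hE01, hE10]
      _ = ∫ η, ((2 * Real.pi)⁻¹ * ⟪ξ - η, EuclideanSpace.single 1 1⟫ / ‖ξ - η‖ ^ 2 * (η 0 * w η) -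
            (2 * Real.pi)⁻¹ * ⟪ξ - η, EuclideanSpace.single 0 1⟫ / ‖ξ - η‖ ^ 2 * (η 1 * w η)) :=
          (integral_sub hK01 hK10).symm
      _ = ∫ η, (2 * Real.pi)⁻¹ * ⟪ξ, perp η⟫ / ‖ξ - η‖ ^ 2 * w η := by
          refine integral_congr_ae (Eventually.of_forall fun η => ?_)
          dsimp only
          rw [inner_fin_two ξ (perp η), perp_apply_zero, perp_apply_one]
          simp only [EuclideanSpace.inner_single_right, conj_trivial, one_mul, PiLp.sub_apply]
          ring
  -- the kernel identity `ξ · K(ξ − η) = −(2π|ξ − η|²)⁻¹ ξ · η^⊥`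
  rw [hR, biotSavart2D, ← integral_inner hK, ← integral_neg]
  refine integral_congr_ae (Eventually.of_forall fun η => ?_)
  dsimp only
  rw [inner_smul_right, biotSavartKernel2D, inner_smul_right, perp_sub, inner_sub_right, inner_self_perp]
  ring

end Summit.AnomalousDissipation.AnomalousDissipation.Theorems.MarginalStabilityChainStretchedVortexRows

end
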